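import Literature.NumberTheory.Sieve.FGKMT2018UniformSieve
import HarnessLib

/-!
# Ford–Green–Konyagin–Maynard–Tao 2018 — §6: Lemma 6.1 and Corollary 4 with explicit constants;
# moments over the uniform residue box (counting Markov / Chebyshev) (PROVED)

Topic `Literature/NumberTheory/Sieve`. Source: K. Ford, B. Green, S. Konyagin, J. Maynard, T. Tao,
*Long gaps between primes*, J. Amer. Math. Soc. 31 (2018) 65–105 = arXiv:1412.5029, §6 pp. 17–19:
Corollary 4 and the first/second-moment computations in the proofs of Lemmas 6.2 and 6.3 («by
linearity of expectation and Markov's inequality», «by Chebyshev's inequality»)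
[FordGreenKonyaginMaynardTao2018].

All probability in §6 is over the FINITE uniform residue box `∏_{s ∈ 𝒮} ℤ/sℤ` of
`FGKMT2018UniformSieve.lean` (and, later, finitely supported laws `ν_p`); this file supplies the
generic finite tools, PROVED:

* `FGKMT2018.card_filter_le_sum_div` — counting Markov: `#{ω ∈ Ω : λ ≤ F ω} ≤ (Σ_Ω F)/λ` for `F ≥ 0`;
* `FGKMT2018.card_filter_abs_sub_le_sum_sq_div` — counting Chebyshev:
  `#{ω ∈ Ω : λ ≤ |F ω − m|} ≤ Σ_Ω (F − m)² / λ²`;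
* `FGKMT2018.boxExp` — expectation under the uniform law on the residue box, with linearity /
  monotonicity lemmas, and `boxExp_indicator = siftProb` (the law of Lemma 6.1);
* `FGKMT2018.siftedCard S f Q = #(Q ∩ S(a⃗))` and the two moment identities
  `E #(Q ∩ S(a⃗)) = Σ_{q ∈ Q} P(q ∈ S(a⃗)) = #Q · σ` (`boxExp_siftedCard`, `siftProb_singleton`) and
  `E #(Q ∩ S(a⃗))² = Σ_{q, q' ∈ Q} P(q, q' ∈ S(a⃗))` (`boxExp_siftedCard_sq`) — the two displays in
  the proof of Corollary 4 (p. 18), before Lemma 6.1 is inserted;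
* `FGKMT2018.sigmaProd S = σ = ∏_{s ∈ S}(1 − 1/s)` ((6.8)) and **Lemma 6.1 assembled with explicit
  constants**: `σ^t e^{−2t² Σ_S 1/s²} ≤ P(T ⊆ S(a⃗)) ≤ σ^t / (1 − t³ log M/(s₀ log s₀))`
  (`lemma61_lower`, `lemma61_upper`; `t = #T`, moduli primes `≥ s₀`, `diam T ≤ M`);
* **Corollary 4 with explicit constants**: `E #(Q ∩ S(a⃗))² ≤ σ#Q + σ²#Q²/(1 − δ)`,
  `Var ≤ σ#Q + σ²#Q² δ/(1 − δ)` with `δ = 8 log M/(s₀ log s₀)`, and the Chebyshev count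
  (`corollary4_secondMoment`, `corollary4_variance`, `corollary4_count`).

With the paper's parameters (`s₀ = log^{20} x`, `M ≤ x²`, `t ≤ 2 log^{1/5} x`) all error factors are
`1 + O(log^{-16} x)`, which is (6.9); the asymptotic evaluation `σ ∼ 80 log₂² x/(log x log₃ x)`
(Mertens) is not part of this file.
-/

noncomputable section

open Finset

namespace Literature.NumberTheory.Sieve

namespace FGKMT2018

/-! ### Counting Markov and Chebyshev inequalities on a finite set -/

/-- **Counting Markov inequality**: for `F ≥ 0` on a finite set `Ω` and `λ > 0`,
`#{ω ∈ Ω : λ ≤ F(ω)} ≤ (Σ_{ω ∈ Ω} F(ω)) / λ`.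
[cite: FordGreenKonyaginMaynardTao2018, §6 p. 18 («by linearity of expectation and Markov's
inequality»)] -/
theorem card_filter_le_sum_div {α : Type*} (Ω : Finset α) (F : α → ℝ) (hF : ∀ ω ∈ Ω, 0 ≤ F ω)
    {t : ℝ} (ht : 0 < t) :
    (#(Ω.filter fun ω => t ≤ F ω) : ℝ) ≤ (∑ ω ∈ Ω, F ω) / t := by
  rw [le_div_iff₀ ht]
  calc (#(Ω.filter fun ω => t ≤ F ω) : ℝ) * t = ∑ ω ∈ Ω.filter (fun ω => t ≤ F ω), t := by
        rw [Finset.sum_const, nsmul_eq_mul]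
    _ ≤ ∑ ω ∈ Ω.filter (fun ω => t ≤ F ω), F ω :=
        Finset.sum_le_sum fun ω hω => (Finset.mem_filter.1 hω).2
    _ ≤ ∑ ω ∈ Ω, F ω :=
        Finset.sum_le_sum_of_subset_of_nonneg (Finset.filter_subset _ _)
          (fun ω hω _ => hF ω hω)

/-- **Counting Chebyshev inequality**: for `F` on a finite set `Ω`, any `m` and `λ > 0`,
`#{ω ∈ Ω : λ ≤ |F(ω) − m|} ≤ Σ_{ω ∈ Ω} (F(ω) − m)² / λ²`.
[cite: FordGreenKonyaginMaynardTao2018, §6 pp. 18–19 («by Chebyshev's inequality»; Lemma (cheb))] -/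
theorem card_filter_abs_sub_le_sum_sq_div {α : Type*} (Ω : Finset α) (F : α → ℝ) (m : ℝ)
    {t : ℝ} (ht : 0 < t) :
    (#(Ω.filter fun ω => t ≤ |F ω - m|) : ℝ) ≤ (∑ ω ∈ Ω, (F ω - m) ^ 2) / t ^ 2 := by
  have h := card_filter_le_sum_div Ω (fun ω => (F ω - m) ^ 2) (fun ω _ => sq_nonneg _)
    (pow_pos ht 2)
  have hsub : (Ω.filter fun ω => t ≤ |F ω - m|) ⊆ Ω.filter fun ω => t ^ 2 ≤ (F ω - m) ^ 2 := by
    intro ω hω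
    simp only [Finset.mem_filter] at hω ⊢
    refine ⟨hω.1, ?_⟩
    calc t ^ 2 ≤ |F ω - m| ^ 2 := pow_le_pow_left₀ ht.le hω.2 2
      _ = (F ω - m) ^ 2 := sq_abs _
  exact le_trans (by exact_mod_cast Finset.card_le_card hsub) h

/-! ### Expectation over the residue box -/

/-- Expectation of `F(a⃗)` for `a⃗` uniform on the residue box `∏_{s ∈ S} ℤ/sℤ`.
[cite: FordGreenKonyaginMaynardTao2018, §6 p. 17] -/
def boxExp (S : Finset ℕ) (F : ((s : ℕ) → s ∈ S → ℕ) → ℝ) : ℝ :=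
  (∑ f ∈ residueBox S, F f) / ∏ s ∈ S, (s : ℝ)

/-- [cite: FordGreenKonyaginMaynardTao2018, §6 p. 17] -/
theorem card_residueBox_cast (S : Finset ℕ) : (#(residueBox S) : ℝ) = ∏ s ∈ S, (s : ℝ) := by
  rw [card_residueBox]; push_cast; rfl

/-- [cite: FordGreenKonyaginMaynardTao2018, §6 p. 17] -/
theorem prod_moduli_pos {S : Finset ℕ} (hS : ∀ s ∈ S, 0 < s) : 0 < ∏ s ∈ S, (s : ℝ) :=
  Finset.prod_pos fun s hs => by exact_mod_cast hS s hs

/-- Linearity: `E[F + G] = E[F] + E[G]`. [cite: FordGreenKonyaginMaynardTao2018, §6 p. 18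
(«by linearity of expectation»)] -/
theorem boxExp_add (S : Finset ℕ) (F G : ((s : ℕ) → s ∈ S → ℕ) → ℝ) :
    boxExp S (fun f => F f + G f) = boxExp S F + boxExp S G := by
  rw [boxExp, boxExp, boxExp, Finset.sum_add_distrib, add_div]

/-- Linearity: `E[F − G] = E[F] − E[G]`. [cite: FordGreenKonyaginMaynardTao2018, §6 p. 19
(«subtracting»)] -/
theorem boxExp_sub (S : Finset ℕ) (F G : ((s : ℕ) → s ∈ S → ℕ) → ℝ) :
    boxExp S (fun f => F f - G f) = boxExp S F - boxExp S G := by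
  rw [boxExp, boxExp, boxExp, Finset.sum_sub_distrib, sub_div]

/-- Linearity: `E[c F] = c E[F]`. [cite: FordGreenKonyaginMaynardTao2018, §6 p. 18] -/
theorem boxExp_const_mul (S : Finset ℕ) (c : ℝ) (F : ((s : ℕ) → s ∈ S → ℕ) → ℝ) :
    boxExp S (fun f => c * F f) = c * boxExp S F := by
  rw [boxExp, boxExp, ← Finset.mul_sum, mul_div_assoc]

/-- Linearity: `E[Σ_i G_i] = Σ_i E[G_i]`. [cite: FordGreenKonyaginMaynardTao2018, §6 p. 18
(«by linearity of expectation»)] -/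
theorem boxExp_sum {ι : Type*} (S : Finset ℕ) (I : Finset ι)
    (G : ι → ((s : ℕ) → s ∈ S → ℕ) → ℝ) :
    boxExp S (fun f => ∑ i ∈ I, G i f) = ∑ i ∈ I, boxExp S (G i) := by
  rw [boxExp, Finset.sum_comm, Finset.sum_div]
  rfl

/-- `E[c] = c` (moduli `≥ 1`). [cite: FordGreenKonyaginMaynardTao2018, §6 p. 17] -/
theorem boxExp_const {S : Finset ℕ} (hS : ∀ s ∈ S, 0 < s) (c : ℝ) :
    boxExp S (fun _ => c) = c := by
  rw [boxExp, Finset.sum_const, nsmul_eq_mul, card_residueBox_cast,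
    mul_div_cancel_left₀ _ (prod_moduli_pos hS).ne']

/-- Monotonicity: `F ≤ G` pointwise on the box ⇒ `E[F] ≤ E[G]`.
[cite: FordGreenKonyaginMaynardTao2018, §6 p. 18] -/
theorem boxExp_mono (S : Finset ℕ) {F G : ((s : ℕ) → s ∈ S → ℕ) → ℝ}
    (h : ∀ f ∈ residueBox S, F f ≤ G f) : boxExp S F ≤ boxExp S G :=
  div_le_div_of_nonneg_right (Finset.sum_le_sum h)
    (Finset.prod_nonneg fun s _ => Nat.cast_nonneg s)

/-- `F ≥ 0` ⇒ `E[F] ≥ 0`. [cite: FordGreenKonyaginMaynardTao2018, §6 p. 18] -/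
theorem boxExp_nonneg (S : Finset ℕ) {F : ((s : ℕ) → s ∈ S → ℕ) → ℝ}
    (h : ∀ f ∈ residueBox S, 0 ≤ F f) : 0 ≤ boxExp S F :=
  div_nonneg (Finset.sum_nonneg h) (Finset.prod_nonneg fun s _ => Nat.cast_nonneg s)

/-- Markov for the box: `P(λ ≤ F) ≤ E[F]/λ`, in counting form
`#{a⃗ : λ ≤ F(a⃗)} ≤ (E[F]/λ) · #box`. [cite: FordGreenKonyaginMaynardTao2018, §6 p. 18 («Markov's
inequality»)] -/
theorem card_box_filter_le {S : Finset ℕ} (hS : ∀ s ∈ S, 0 < s) (F : ((s : ℕ) → s ∈ S → ℕ) → ℝ)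
    (hF : ∀ f ∈ residueBox S, 0 ≤ F f) {t : ℝ} (ht : 0 < t) :
    (#((residueBox S).filter fun f => t ≤ F f) : ℝ) ≤ boxExp S F / t * ∏ s ∈ S, (s : ℝ) := by
  have h := card_filter_le_sum_div (residueBox S) F hF ht
  rw [boxExp, div_right_comm, div_mul_cancel₀ _ (prod_moduli_pos hS).ne']
  exact h

/-! ### The sifting indicator and the moments of `#(Q ∩ S(a⃗))` -/

/-- The indicator of the event `T ⊆ S(a⃗)`. [cite: FordGreenKonyaginMaynardTao2018, Lemma 6.1
(p. 17)] -/
def siftInd (S : Finset ℕ) (T : Finset ℤ) (f : (s : ℕ) → s ∈ S → ℕ) : ℝ :=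
  if ∀ s (h : s ∈ S), ∀ n ∈ T, ¬ n ≡ (f s h : ℤ) [ZMOD (s : ℤ)] then 1 else 0

/-- [cite: FordGreenKonyaginMaynardTao2018, Lemma 6.1 (p. 17)] -/
theorem siftInd_nonneg (S : Finset ℕ) (T : Finset ℤ) (f : (s : ℕ) → s ∈ S → ℕ) :
    0 ≤ siftInd S T f := by
  unfold siftInd; split_ifs <;> norm_num

/-- [cite: FordGreenKonyaginMaynardTao2018, Lemma 6.1 (p. 17)] -/
theorem siftInd_le_one (S : Finset ℕ) (T : Finset ℤ) (f : (s : ℕ) → s ∈ S → ℕ) :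
    siftInd S T f ≤ 1 := by
  unfold siftInd; split_ifs <;> norm_num

/-- `E[1_{T ⊆ S(a⃗)}] = P(T ⊆ S(a⃗))` (= `siftProb`, computed by Lemma 6.1).
[cite: FordGreenKonyaginMaynardTao2018, Lemma 6.1 (p. 17)] -/
theorem boxExp_siftInd (S : Finset ℕ) (T : Finset ℤ) :
    boxExp S (siftInd S T) = siftProb S T := by
  rw [boxExp, siftProb, siftCount]
  congr 1
  rw [Finset.natCast_card_filter]
  rfl

/-- The product of two sifting indicators is the indicator of the union:
`1_{T ⊆ S(a⃗)} 1_{T' ⊆ S(a⃗)} = 1_{T ∪ T' ⊆ S(a⃗)}`.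
[cite: FordGreenKonyaginMaynardTao2018, Cor 4 (proof, p. 18)] -/
theorem siftInd_mul (S : Finset ℕ) (T T' : Finset ℤ) (f : (s : ℕ) → s ∈ S → ℕ) :
    siftInd S T f * siftInd S T' f = siftInd S (T ∪ T') f := by
  unfold siftInd
  by_cases h1 : ∀ s (h : s ∈ S), ∀ n ∈ T, ¬ n ≡ (f s h : ℤ) [ZMOD (s : ℤ)]
  · by_cases h2 : ∀ s (h : s ∈ S), ∀ n ∈ T', ¬ n ≡ (f s h : ℤ) [ZMOD (s : ℤ)]
    · have h3 : ∀ s (h : s ∈ S), ∀ n ∈ T ∪ T', ¬ n ≡ (f s h : ℤ) [ZMOD (s : ℤ)] := by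
        intro s h n hn
        rcases Finset.mem_union.1 hn with hn | hn
        · exact h1 s h n hn
        · exact h2 s h n hn
      rw [if_pos h1, if_pos h2, if_pos h3, one_mul]
    · have h3 : ¬ ∀ s (h : s ∈ S), ∀ n ∈ T ∪ T', ¬ n ≡ (f s h : ℤ) [ZMOD (s : ℤ)] :=
        fun H => h2 fun s h n hn => H s h n (Finset.mem_union_right _ hn)
      rw [if_pos h1, if_neg h2, if_neg h3, one_mul]
  · have h3 : ¬ ∀ s (h : s ∈ S), ∀ n ∈ T ∪ T', ¬ n ≡ (f s h : ℤ) [ZMOD (s : ℤ)] :=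
      fun H => h1 fun s h n hn => H s h n (Finset.mem_union_left _ hn)
    rw [if_neg h1, if_neg h3, zero_mul]

/-- `#(Q ∩ S(a⃗))`: the number of `q ∈ Q` surviving the sieve by `a⃗`.
[cite: FordGreenKonyaginMaynardTao2018, Cor 4 (p. 18)] -/
def siftedCard (S : Finset ℕ) (f : (s : ℕ) → s ∈ S → ℕ) (Q : Finset ℤ) : ℕ :=
  #(Q.filter fun q => ∀ s (h : s ∈ S), ¬ q ≡ (f s h : ℤ) [ZMOD (s : ℤ)])

/-- `#(Q ∩ S(a⃗)) = Σ_{q ∈ Q} 1_{q ∈ S(a⃗)}`. [cite: FordGreenKonyaginMaynardTao2018, Cor 4 (proof,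
p. 18)] -/
theorem siftedCard_eq_sum (S : Finset ℕ) (f : (s : ℕ) → s ∈ S → ℕ) (Q : Finset ℤ) :
    (siftedCard S f Q : ℝ) = ∑ q ∈ Q, siftInd S {q} f := by
  rw [siftedCard, Finset.natCast_card_filter]
  refine Finset.sum_congr rfl fun q _ => ?_
  unfold siftInd
  have : (∀ s (h : s ∈ S), ∀ n ∈ ({q} : Finset ℤ), ¬ n ≡ (f s h : ℤ) [ZMOD (s : ℤ)]) ↔
      ∀ s (h : s ∈ S), ¬ q ≡ (f s h : ℤ) [ZMOD (s : ℤ)] := by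
    simp only [Finset.mem_singleton, forall_eq]
  by_cases hq : ∀ s (h : s ∈ S), ¬ q ≡ (f s h : ℤ) [ZMOD (s : ℤ)]
  · rw [if_pos hq, if_pos (this.2 hq)]
  · rw [if_neg hq, if_neg (fun H => hq (this.1 H))]

/-- **First moment**: `E #(Q ∩ S(a⃗)) = Σ_{q ∈ Q} P(q ∈ S(a⃗))`.
[cite: FordGreenKonyaginMaynardTao2018, Cor 4 (proof, p. 18, first display)] -/
theorem boxExp_siftedCard (S : Finset ℕ) (Q : Finset ℤ) :
    boxExp S (fun f => (siftedCard S f Q : ℝ)) = ∑ q ∈ Q, siftProb S {q} := by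
  simp_rw [siftedCard_eq_sum]
  rw [boxExp_sum]
  exact Finset.sum_congr rfl fun q _ => boxExp_siftInd S {q}

/-- The law of one element is EXACT: `P(q ∈ S(a⃗)) = ∏_{s ∈ S} (1 − 1/s) = σ` (one hit residue
modulo each `s`). [cite: FordGreenKonyaginMaynardTao2018, §6 p. 17 («S(a⃗) is a random periodic
subset of ℤ with density σ»)] -/
theorem siftProb_singleton {S : Finset ℕ} (hS : ∀ s ∈ S, 0 < s) (q : ℤ) :
    siftProb S {q} = ∏ s ∈ S, (1 - 1 / (s : ℝ)) := by
  rw [siftProb_eq_prod hS]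
  refine Finset.prod_congr rfl fun s _ => ?_
  rw [hitRes, Finset.image_singleton, Finset.card_singleton, Nat.cast_one]

/-- `E #(Q ∩ S(a⃗)) = σ · #Q`. [cite: FordGreenKonyaginMaynardTao2018, Cor 4 (proof, p. 18)] -/
theorem boxExp_siftedCard_eq {S : Finset ℕ} (hS : ∀ s ∈ S, 0 < s) (Q : Finset ℤ) :
    boxExp S (fun f => (siftedCard S f Q : ℝ)) = (∏ s ∈ S, (1 - 1 / (s : ℝ))) * #Q := by
  rw [boxExp_siftedCard, Finset.sum_congr rfl fun q _ => siftProb_singleton hS q, Finset.sum_const,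
    nsmul_eq_mul, mul_comm]

/-- **Second moment**: `E #(Q ∩ S(a⃗))² = Σ_{q, q' ∈ Q} P(q, q' ∈ S(a⃗))`.
[cite: FordGreenKonyaginMaynardTao2018, Cor 4 (proof, p. 18, second display)] -/
theorem boxExp_siftedCard_sq (S : Finset ℕ) (Q : Finset ℤ) :
    boxExp S (fun f => (siftedCard S f Q : ℝ) ^ 2) = ∑ q ∈ Q, ∑ q' ∈ Q, siftProb S {q, q'} := by
  have h : ∀ f, (siftedCard S f Q : ℝ) ^ 2 = ∑ q ∈ Q, ∑ q' ∈ Q, siftInd S {q, q'} f := by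
    intro f
    rw [siftedCard_eq_sum, sq, Finset.sum_mul_sum]
    refine Finset.sum_congr rfl fun q _ => Finset.sum_congr rfl fun q' _ => ?_
    rw [siftInd_mul]
    congr 1
  simp_rw [h]
  rw [boxExp_sum]
  refine Finset.sum_congr rfl fun q _ => ?_
  rw [boxExp_sum]
  exact Finset.sum_congr rfl fun q' _ => boxExp_siftInd S {q, q'}

/-- **Variance form**: `E (#(Q ∩ S(a⃗)) − M)² = E #² − 2 M · E # + M²`.
[cite: FordGreenKonyaginMaynardTao2018, Cor 4 (proof, p. 18: «mean … and variance …»)] -/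
theorem boxExp_siftedCard_sub_sq {S : Finset ℕ} (hS : ∀ s ∈ S, 0 < s) (Q : Finset ℤ) (M : ℝ) :
    boxExp S (fun f => ((siftedCard S f Q : ℝ) - M) ^ 2) =
      boxExp S (fun f => (siftedCard S f Q : ℝ) ^ 2)
        - 2 * M * boxExp S (fun f => (siftedCard S f Q : ℝ)) + M ^ 2 := by
  have h : ∀ f, ((siftedCard S f Q : ℝ) - M) ^ 2 =
      (siftedCard S f Q : ℝ) ^ 2 - 2 * M * (siftedCard S f Q : ℝ) + M ^ 2 := fun f => by ring
  simp_rw [h]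
  rw [boxExp_add, boxExp_sub, boxExp_const_mul, boxExp_const hS]

/-- **Chebyshev for `#(Q ∩ S(a⃗))`**, counting form: for `λ > 0` and any `M`,
`#{a⃗ : λ ≤ |#(Q ∩ S(a⃗)) − M|} ≤ E(# − M)²/λ² · #box`.
[cite: FordGreenKonyaginMaynardTao2018, Cor 4 (proof, p. 18: «The claim then follows from
Chebyshev's inequality»)] -/
theorem card_box_filter_siftedCard_le {S : Finset ℕ} (hS : ∀ s ∈ S, 0 < s) (Q : Finset ℤ)
    (M : ℝ) {t : ℝ} (ht : 0 < t) :
    (#((residueBox S).filter fun f => t ≤ |(siftedCard S f Q : ℝ) - M|) : ℝ) ≤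
      boxExp S (fun f => ((siftedCard S f Q : ℝ) - M) ^ 2) / t ^ 2 * ∏ s ∈ S, (s : ℝ) := by
  have h := card_filter_abs_sub_le_sum_sq_div (residueBox S)
    (fun f => (siftedCard S f Q : ℝ)) M ht
  rw [boxExp, div_right_comm, div_mul_cancel₀ _ (prod_moduli_pos hS).ne']
  exact h

/-! ### Lemma 6.1 assembled and Corollary 4, with explicit constants -/

/-- `σ = σ(S) := ∏_{s ∈ S} (1 − 1/s)`, the density of `S(a⃗)` ((6.8), p. 17).
[cite: FordGreenKonyaginMaynardTao2018, (6.8) p. 17] -/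
def sigmaProd (S : Finset ℕ) : ℝ := ∏ s ∈ S, (1 - 1 / (s : ℝ))

/-- [cite: FordGreenKonyaginMaynardTao2018, (6.8) p. 17] -/
theorem sigmaProd_nonneg {S : Finset ℕ} (hS : ∀ s ∈ S, 0 < s) : 0 ≤ sigmaProd S :=
  Finset.prod_nonneg fun s hs => by
    have : (1 : ℝ) ≤ s := by exact_mod_cast hS s hs
    have : 1 / (s : ℝ) ≤ 1 := (div_le_one (by linarith)).2 this
    linarith

/-- [cite: FordGreenKonyaginMaynardTao2018, (6.8) p. 17] -/
theorem sigmaProd_le_one {S : Finset ℕ} (hS : ∀ s ∈ S, 0 < s) : sigmaProd S ≤ 1 :=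
  Finset.prod_le_one
    (fun s hs => by
      have : (1 : ℝ) ≤ s := by exact_mod_cast hS s hs
      have : 1 / (s : ℝ) ≤ 1 := (div_le_one (by linarith)).2 this
      linarith)
    (fun s _ => by
      have : 0 ≤ 1 / (s : ℝ) := by positivity
      linarith)

/-- `P(q ∈ S(a⃗)) = σ` exactly. [cite: FordGreenKonyaginMaynardTao2018, §6 p. 17] -/
theorem siftProb_singleton_eq_sigmaProd {S : Finset ℕ} (hS : ∀ s ∈ S, 0 < s) (q : ℤ) :
    siftProb S {q} = sigmaProd S :=
  siftProb_singleton hS q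

/-- **Lemma 6.1, lower bound (explicit form).** If `2 #T ≤ s` for every modulus `s ∈ S`, then
`σ^{#T} · exp(−2 #T² Σ_{s ∈ S} 1/s²) ≤ P(T ⊆ S(a⃗))`.
(In the paper `s ≥ log^{20} x`, `#T ≤ 2 log^{1/5} x`, so the exponential is `1 + O(log^{-19} x)`.)
[cite: FordGreenKonyaginMaynardTao2018, Lemma 6.1 (6.9), pp. 17–18] -/
theorem lemma61_lower {S : Finset ℕ} (hS : ∀ s ∈ S, 0 < s) {T : Finset ℤ}
    (hT : ∀ s ∈ S, 2 * #T ≤ s) :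
    sigmaProd S ^ #T * Real.exp (-(2 * (#T : ℝ) ^ 2 * ∑ s ∈ S, 1 / (s : ℝ) ^ 2)) ≤
      siftProb S T := by
  unfold sigmaProd
  have h1 := pow_le_prod_one_sub_div_mul_exp hS (#T) hT
  have h2 := prod_le_siftProb hS (T := T) (fun s hs => by have := hT s hs; omega)
  set E := 2 * (#T : ℝ) ^ 2 * ∑ s ∈ S, 1 / (s : ℝ) ^ 2
  calc (∏ s ∈ S, (1 - 1 / (s : ℝ))) ^ #T * Real.exp (-E)
        ≤ ((∏ s ∈ S, (1 - (#T : ℝ) / s)) * Real.exp E) * Real.exp (-E) :=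
        mul_le_mul_of_nonneg_right h1 (Real.exp_pos _).le
    _ = ∏ s ∈ S, (1 - (#T : ℝ) / s) := by
        rw [mul_assoc, ← Real.exp_add, add_neg_cancel, Real.exp_zero, mul_one]
    _ ≤ siftProb S T := h2

/-- **Lemma 6.1, upper bound (explicit form).** If the moduli are primes `≥ s₀ ≥ 2`, `#T ≤ s₀`,
all differences of elements of `T` are `≤ M` (`M ≥ 1`) in absolute value and
`δ := #T³ log M / (s₀ log s₀) < 1`, then `P(T ⊆ S(a⃗)) ≤ σ^{#T} / (1 − δ)`.
(In the paper `s₀ = log^{20} x`, `M = O(x²)`, `#T ≤ 2 log^{1/5} x`, so `δ = O(log^{-18} x)`.)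
[cite: FordGreenKonyaginMaynardTao2018, Lemma 6.1 (6.9), pp. 17–18] -/
theorem lemma61_upper {S : Finset ℕ} (hS : ∀ s ∈ S, s.Prime) {s₀ : ℕ} (hs₀ : 2 ≤ s₀)
    (hSs₀ : ∀ s ∈ S, s₀ ≤ s) {T : Finset ℤ} {M : ℝ} (hM1 : 1 ≤ M)
    (hM : ∀ n ∈ T, ∀ n' ∈ T, (|n - n'| : ℝ) ≤ M) (hT : #T ≤ s₀)
    (hδ : (#T : ℝ) ^ 3 * Real.log M / (s₀ * Real.log s₀) < 1) :
    siftProb S T ≤ sigmaProd S ^ #T / (1 - (#T : ℝ) ^ 3 * Real.log M / (s₀ * Real.log s₀)) := by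
  have hS' : ∀ s ∈ S, 0 < s := fun s hs => (hS s hs).pos
  have hs₀pos : 0 < s₀ := by omega
  have hs₀' : (0 : ℝ) < s₀ := by exact_mod_cast hs₀pos
  set B := exceptional S T with hBdef
  set δ := (#T : ℝ) ^ 3 * Real.log M / (s₀ * Real.log s₀) with hδdef
  have hBsub : B ⊆ S := exceptional_subset S T
  have hcardB : (#B : ℝ) ≤ (#T : ℝ) ^ 2 * (Real.log M / Real.log s₀) :=
    card_exceptional_le hS hs₀ hSs₀ hM1 hM
  -- `∏_B (1 − t/s) ≥ 1 − t #B / s₀ ≥ 1 − δ`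
  have hPB : 1 - δ ≤ ∏ s ∈ B, (1 - (#T : ℝ) / s) := by
    have h := one_sub_le_prod_exceptional (B := B) (t := #T) hs₀pos
      (fun s hs => hSs₀ s (hBsub hs)) hT
    refine le_trans ?_ h
    have h1 : (#T : ℝ) * #B / s₀ ≤ (#T : ℝ) * ((#T : ℝ) ^ 2 * (Real.log M / Real.log s₀)) / s₀ := by
      gcongr
    have h2 : (#T : ℝ) * ((#T : ℝ) ^ 2 * (Real.log M / Real.log s₀)) / s₀ = δ := by
      rw [hδdef]; ring
    linarith
  have hPBpos : 0 < ∏ s ∈ B, (1 - (#T : ℝ) / s) := lt_of_lt_of_le (by linarith) hPB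
  have hσ : ∏ s ∈ S, (1 - (#T : ℝ) / s) ≤ sigmaProd S ^ #T :=
    prod_one_sub_div_le_pow hS' (#T) (fun s hs => hT.trans (hSs₀ s hs))
  have hsplit : (∏ s ∈ S \ B, (1 - (#T : ℝ) / s)) * ∏ s ∈ B, (1 - (#T : ℝ) / s) =
      ∏ s ∈ S, (1 - (#T : ℝ) / s) := Finset.prod_sdiff hBsub
  calc siftProb S T ≤ ∏ s ∈ S \ B, (1 - (#T : ℝ) / s) := siftProb_le_prod_sdiff hS' T
    _ = (∏ s ∈ S, (1 - (#T : ℝ) / s)) / ∏ s ∈ B, (1 - (#T : ℝ) / s) := by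
        rw [← hsplit, mul_div_cancel_right₀ _ hPBpos.ne']
    _ ≤ sigmaProd S ^ #T / ∏ s ∈ B, (1 - (#T : ℝ) / s) :=
        div_le_div_of_nonneg_right hσ hPBpos.le
    _ ≤ sigmaProd S ^ #T / (1 - δ) :=
        div_le_div_of_nonneg_left (pow_nonneg (sigmaProd_nonneg hS') _) (by linarith) hPB

/-- **Corollary 4, second moment (explicit form).** For primes moduli `≥ s₀ ≥ 2` and a finite set
`Q ⊆ ℤ` of diameter `≤ M` (`M ≥ 1`) with `δ := 8 log M / (s₀ log s₀) < 1`,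
`E #(Q ∩ S(a⃗))² ≤ σ #Q + σ² #Q² / (1 − δ)`.
[cite: FordGreenKonyaginMaynardTao2018, Cor 4 (proof, p. 18, second display)] -/
theorem corollary4_secondMoment {S : Finset ℕ} (hS : ∀ s ∈ S, s.Prime) {s₀ : ℕ} (hs₀ : 2 ≤ s₀)
    (hSs₀ : ∀ s ∈ S, s₀ ≤ s) (Q : Finset ℤ) {M : ℝ} (hM1 : 1 ≤ M)
    (hM : ∀ q ∈ Q, ∀ q' ∈ Q, (|q - q'| : ℝ) ≤ M)
    (hδ : 8 * Real.log M / (s₀ * Real.log s₀) < 1) :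
    boxExp S (fun f => (siftedCard S f Q : ℝ) ^ 2) ≤
      sigmaProd S * #Q + sigmaProd S ^ 2 * (#Q : ℝ) ^ 2 / (1 - 8 * Real.log M / (s₀ * Real.log s₀)) := by
  have hS' : ∀ s ∈ S, 0 < s := fun s hs => (hS s hs).pos
  set δ := 8 * Real.log M / (s₀ * Real.log s₀) with hδdef
  set σ := sigmaProd S with hσdef
  have hσ0 : 0 ≤ σ := sigmaProd_nonneg hS'
  have h1δ : 0 < 1 - δ := by linarith
  -- the pair law
  have hpair : ∀ q ∈ Q, ∀ q' ∈ Q, q' ≠ q → siftProb S {q, q'} ≤ σ ^ 2 / (1 - δ) := by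
    intro q hq q' hq' hne
    have hcard : #({q, q'} : Finset ℤ) = 2 := Finset.card_pair (Ne.symm hne)
    have hM' : ∀ n ∈ ({q, q'} : Finset ℤ), ∀ n' ∈ ({q, q'} : Finset ℤ), (|n - n'| : ℝ) ≤ M := by
      intro n hn n' hn'
      simp only [Finset.mem_insert, Finset.mem_singleton] at hn hn'
      rcases hn with rfl | rfl <;> rcases hn' with rfl | rfl
      · exact hM _ hq _ hq
      · exact hM _ hq _ hq'
      · exact hM _ hq' _ hq
      · exact hM _ hq' _ hq'
    have hT : #({q, q'} : Finset ℤ) ≤ s₀ := by rw [hcard]; exact hs₀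
    have hδ' : (#({q, q'} : Finset ℤ) : ℝ) ^ 3 * Real.log M / (s₀ * Real.log s₀) < 1 := by
      rw [hcard]; norm_num; exact hδ
    have h := lemma61_upper hS hs₀ hSs₀ hM1 hM' hT hδ'
    rw [hcard] at h
    norm_num at h
    exact h
  rw [boxExp_siftedCard_sq]
  -- inner sums
  have hinner : ∀ q ∈ Q, ∑ q' ∈ Q, siftProb S {q, q'} ≤ σ + #Q * (σ ^ 2 / (1 - δ)) := by
    intro q hq
    rw [← Finset.add_sum_erase Q _ hq]
    have hdiag : siftProb S ({q, q} : Finset ℤ) = σ := by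
      rw [Finset.insert_eq_self.2 (Finset.mem_singleton_self q)]
      exact siftProb_singleton_eq_sigmaProd hS' q
    rw [hdiag]
    have hoff : ∑ q' ∈ Q.erase q, siftProb S {q, q'} ≤ ∑ q' ∈ Q.erase q, σ ^ 2 / (1 - δ) :=
      Finset.sum_le_sum fun q' hq' =>
        hpair q hq q' (Finset.mem_of_mem_erase hq') (Finset.ne_of_mem_erase hq')
    rw [Finset.sum_const, nsmul_eq_mul] at hoff
    have hcard : (#(Q.erase q) : ℝ) ≤ #Q := by exact_mod_cast Finset.card_erase_le
    have hnn : 0 ≤ σ ^ 2 / (1 - δ) := div_nonneg (sq_nonneg _) h1δ.le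
    have : (#(Q.erase q) : ℝ) * (σ ^ 2 / (1 - δ)) ≤ #Q * (σ ^ 2 / (1 - δ)) :=
      mul_le_mul_of_nonneg_right hcard hnn
    linarith
  calc ∑ q ∈ Q, ∑ q' ∈ Q, siftProb S {q, q'} ≤ ∑ q ∈ Q, (σ + #Q * (σ ^ 2 / (1 - δ))) :=
        Finset.sum_le_sum hinner
    _ = σ * #Q + σ ^ 2 * (#Q : ℝ) ^ 2 / (1 - δ) := by
        rw [Finset.sum_const, nsmul_eq_mul]; ring

/-- **Corollary 4, variance (explicit form).** Under the hypotheses of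
`corollary4_secondMoment`, with `δ := 8 log M / (s₀ log s₀) < 1`,
`E (#(Q ∩ S(a⃗)) − σ #Q)² ≤ σ #Q + σ² #Q² · δ/(1 − δ)` (the paper: «variance
`O(log^{-16} x · (σ y/log x)²)`»). [cite: FordGreenKonyaginMaynardTao2018, Cor 4 (proof, p. 18)] -/
theorem corollary4_variance {S : Finset ℕ} (hS : ∀ s ∈ S, s.Prime) {s₀ : ℕ} (hs₀ : 2 ≤ s₀)
    (hSs₀ : ∀ s ∈ S, s₀ ≤ s) (Q : Finset ℤ) {M : ℝ} (hM1 : 1 ≤ M)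
    (hM : ∀ q ∈ Q, ∀ q' ∈ Q, (|q - q'| : ℝ) ≤ M)
    (hδ : 8 * Real.log M / (s₀ * Real.log s₀) < 1) :
    boxExp S (fun f => ((siftedCard S f Q : ℝ) - sigmaProd S * #Q) ^ 2) ≤
      sigmaProd S * #Q + sigmaProd S ^ 2 * (#Q : ℝ) ^ 2 *
        (8 * Real.log M / (s₀ * Real.log s₀) / (1 - 8 * Real.log M / (s₀ * Real.log s₀))) := by
  have hS' : ∀ s ∈ S, 0 < s := fun s hs => (hS s hs).pos
  have h2 := corollary4_secondMoment hS hs₀ hSs₀ Q hM1 hM hδ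
  rw [boxExp_siftedCard_sub_sq hS', boxExp_siftedCard_eq hS']
  set δ := 8 * Real.log M / (s₀ * Real.log s₀) with hδdef
  have hsq : (∏ s ∈ S, (1 - 1 / (s : ℝ))) = sigmaProd S := rfl
  rw [hsq]
  set σ := sigmaProd S with hσdef
  have h1δ : 0 < 1 - δ := by linarith
  have hid : 1 + δ / (1 - δ) = 1 / (1 - δ) := by rw [one_add_div h1δ.ne', sub_add_cancel]
  have key : σ ^ 2 * (#Q : ℝ) ^ 2 / (1 - δ) =
      σ ^ 2 * (#Q : ℝ) ^ 2 + σ ^ 2 * (#Q : ℝ) ^ 2 * (δ / (1 - δ)) := by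
    rw [div_eq_mul_one_div, ← hid, mul_add, mul_one]
  rw [key] at h2
  nlinarith [h2]

/-- **Corollary 4, counting form (Chebyshev).** Under the same hypotheses, for every `λ > 0` the
number of residue vectors `a⃗` with `|#(Q ∩ S(a⃗)) − σ #Q| ≥ λ` is at most
`(σ #Q + σ² #Q² δ/(1 − δ)) / λ² · #box`. With the paper's parameters (`#Q ≍ y/log x`,
`σ ≍ log₂² x/(log x log₃ x)`, `δ = O(log^{-19} x)`, `λ = σ#Q / log³ x`, say) this is
`o(#box)`: «`#(𝒬 ∩ S(a⃗)) ∼ σ y/log x` with probability `1 − o(1)`».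
[cite: FordGreenKonyaginMaynardTao2018, Cor 4 (6.10), p. 18] -/
theorem corollary4_count {S : Finset ℕ} (hS : ∀ s ∈ S, s.Prime) {s₀ : ℕ} (hs₀ : 2 ≤ s₀)
    (hSs₀ : ∀ s ∈ S, s₀ ≤ s) (Q : Finset ℤ) {M : ℝ} (hM1 : 1 ≤ M)
    (hM : ∀ q ∈ Q, ∀ q' ∈ Q, (|q - q'| : ℝ) ≤ M)
    (hδ : 8 * Real.log M / (s₀ * Real.log s₀) < 1) {t : ℝ} (ht : 0 < t) :
    (#((residueBox S).filter fun f => t ≤ |(siftedCard S f Q : ℝ) - sigmaProd S * #Q|) : ℝ) ≤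
      (sigmaProd S * #Q + sigmaProd S ^ 2 * (#Q : ℝ) ^ 2 *
        (8 * Real.log M / (s₀ * Real.log s₀) / (1 - 8 * Real.log M / (s₀ * Real.log s₀)))) / t ^ 2 *
        ∏ s ∈ S, (s : ℝ) := by
  have hS' : ∀ s ∈ S, 0 < s := fun s hs => (hS s hs).pos
  have h1 := card_box_filter_siftedCard_le hS' Q (sigmaProd S * #Q) ht
  have h2 := corollary4_variance hS hs₀ hSs₀ Q hM1 hM hδ
  refine h1.trans ?_
  have hP : 0 ≤ ∏ s ∈ S, (s : ℝ) := (prod_moduli_pos hS').le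
  exact mul_le_mul_of_nonneg_right (div_le_div_of_nonneg_right h2 (pow_pos ht 2).le) hP


end FGKMT2018

end Literature.NumberTheory.Sieve
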